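/-
Copyright: the b2b-balaban cell (near-miss cell 7), T⁴-continuum fan-out; row NE7b ROUND-2 swarm, seat
t4-ne7b-formalise-leaf-10 (gen 2; row S6g′(a) «cardinality law», GEOMETRIC CORE, second seat — holder of (a):
t4-ne7b-formalise-leaf-01; owner's ruling R-OWNER-22-12 (2)).  Released under the licence of the surrounding project.
-/
import Summits.QuantumFields.BalabanUV.T4Continuum.Support.HistoryZonesTolerant

/-!
# Zone mass, geometric core: a LINKED set meets few coarse blocks (row S6g′(a) pt 1)

Summits-side support leaf of the T⁴-continuum cell (rung (B)+1 on a FINITE torus only; NOT infinite volume, NOT the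
mass gap, NOT the Clay statement; NOT a proof of the spine estimate NE7b).  Row NE7b, route «COUNT», row S6g′
«MASS-BASED SIBLING COUNT» (R-OWNER-22-12 (2)), step (a) = the CARDINALITY LAW of the zone reading (decayed mass):
its set-level core on the torus `(ℤ∕m)^d` of `Support/ZoneDiameter` ∕ `Support/HistoryZonesTolerant` (cells
`Fin d → ℕ` in range, cyclic sup-distance `cdist`, blockings `blocks`, thickenings `thickT`).  [folklore] finite
geometry; nothing is quoted from print, nothing printed is asserted, no `[cite:]` tag, no `Prop`-valued fact is minted
(`Linked` is a predicate with parameters); constants explicit (`(2c+1)^d`, `5^d`).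

WHY (rows S6g′(b)(c)(d′): `HistoryMassPlacement`'s `hcard`, `HistorySiblingSymmetry`'s host-side factor,
`HistorySiblingMassLayered.layered_cost_le_of_budget`).  The placement counts charge every attachment against the
CARDINALITY of the attachable zone, and the total of these cardinalities over all joins must be class-linear; the
union bound over the births is not (one unit per birth per join — quadratic on an absorption chain), so the law must
DECAY, and the cardinality of a zone contracts under blocking only for LINKED (connected) sets.  §3 is that
contraction; §4 collapses the tolerant step law `zone (t+1) ⊆ thickT c (blocks L (zone t))` over several steps.

WHAT.  §1 `card_cball_le` (a cyclic sup-ball of radius `c` has `≤ (2c+1)^d` cells), **`card_thickT_le`**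
(`#thickT m c S ≤ (2c+1)^d·#S`).  §2 **`Linked m ρ S`** (every two cells of `S` joined by a chain IN `S` with consecutive
`cdist ≤ ρ`) and its closure: `Linked.mono`, **`linked_union`** (two linked sets sharing a cell), **`linked_thickT`**
(radius `max ρ c`), **`linked_blocks`** (radius `ρ∕L + 1`), **`linked_redZone`** (the torus reduction of a
face-connected cube family is `1`-linked).  §3 THE CORE **`card_blocks_le_of_linked`**: `S` in range `m·N`, `ρ`-linked,
`1 ≤ ρ`, `1 ≤ N` ⇒ `#blocks N S · N ≤ 5^d·(ρ·#S + N)` (real form `…_real`: `#blocks N S ≤ 5^d·(ρ·#S∕N + 1)`).  Proof: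
a 3-separated sub-family `T` of the met blocks of MAXIMAL size covers them within distance 2 (`#blocks ≤ 5^d·#T`);
representatives `z_t ∈ S` of distinct `t ∈ T` are `≥ 2N` apart; along a linking chain from `z_t` the attained
distances are `ρ`-dense (`exists_mem_cdist_window`), so the radius-`(N−1)` territories of the `z_t` in `S` — pairwise
disjoint — hold `≥ ⌊(N−1)∕ρ⌋ + 1 ≥ N∕ρ` cells each.  §4 **`blocks_thickT_subset`**
(`blocks L (thickT (m·L) c S) ⊆ thickT m (c∕L + 1) (blocks L S)`), **`thickT_thickT_subset`**, `thickT_mono_radius`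
(with `HistoryZones.blocks_blocks`, two tolerant steps lie in ONE blocking by `L·L` and ONE thickening by `c + c∕L + 1`).  §5 sanity (decided).

NOT HERE (pt 2; holder of row (a): t4-ne7b-formalise-leaf-01): the law itself over `ZoneReadingC` with a `linked`
reading field — the one-stage inequality `Φ_t(p) ≤ a·Σ_{q ∈ Anc_{t−s}(p)} Φ_{t−s}(q) + A·#Anc + C₁·F_recent`
(`a = (2c_s+1)^d·5^d·ρ·L^{−s} ≤ 1∕2` for a fixed `s`), its closed-form majorant in the currency `ZoneDrivers.qZ` (weights
on births AND mergers) with the class-linear total, and the binding.  NE7b NOT proved.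
HONEST DEPENDENCY (cell): continuum YM on T⁴ ⇐ BetaPertH ∧ nine spine estimates (0/9 proved); BetaPertH ⇐ (D1) ∧ (D4)
∧ CAP+tail; G-an2-4 gates asym, D1 and NE2/3/4.  This file changes none of it.
-/

open Finset
open Literature.MathematicalPhysics.QuantumFieldTheory.Balaban1983to89
open Summit.QuantumFields.BalabanUV.T4Continuum.ZoneTorus
open Summit.QuantumFields.BalabanUV.T4Continuum.HistoryZones

namespace Summit.QuantumFields.BalabanUV.T4Continuum.HistoryZoneMass

noncomputable section

variable {d : ℕ}

/-! ## §1 Balls and thickenings -/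

/-- a cell is at cyclic sup-distance `0` from itself [folklore] -/
theorem cdist_self (m : ℕ) (u : Fin d → ℕ) : cdist m u u = 0 :=
  le_antisymm (by rw [cdist_le_iff]; intro i; simp [cycd]) (Nat.zero_le _)

/-- **A CYCLIC SUP-BALL OF RADIUS `c` HAS AT MOST `(2c+1)^d` CELLS** (product of `ZoneTorus.card_cycBall_le`).
[folklore] -/
theorem card_cball_le {m c : ℕ} {v : Fin d → ℕ} (hv : ∀ i, v i < m) :
    ((Fintype.piFinset fun _ : Fin d => range m).filter fun u => cdist m u v ≤ c).card ≤ (2 * c + 1) ^ d := by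
  have hset : ((Fintype.piFinset fun _ : Fin d => range m).filter fun u => cdist m u v ≤ c) =
      Fintype.piFinset fun i => (range m).filter fun a => cycd m (v i) a ≤ c := by
    ext u
    simp only [mem_filter, Fintype.mem_piFinset, cdist_le_iff, mem_range]
    constructor
    · rintro ⟨hr, hc⟩ i
      exact ⟨hr i, by rw [cycd_comm]; exact hc i⟩
    · intro h
      exact ⟨fun i => (h i).1, fun i => by rw [cycd_comm]; exact (h i).2⟩
  rw [hset, Fintype.card_piFinset]
  calc ∏ i, ((range m).filter fun a => cycd m (v i) a ≤ c).card ≤ ∏ _i : Fin d, (2 * c + 1) :=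
        prod_le_prod (fun _ _ => Nat.zero_le _) fun i _ => card_cycBall_le (hv i) c
    _ = (2 * c + 1) ^ d := by rw [prod_const, card_univ, Fintype.card_fin]

/-- **THICKENING MULTIPLIES THE CARDINALITY BY AT MOST `(2c+1)^d`.** [folklore] -/
theorem card_thickT_le {m : ℕ} (c : ℕ) {S : Finset (Fin d → ℕ)} (hS : InRange m S) :
    (thickT m c S).card ≤ (2 * c + 1) ^ d * S.card := by
  have hsub : thickT m c S ⊆ S.biUnion fun v =>
      (Fintype.piFinset fun _ : Fin d => range m).filter fun u => cdist m u v ≤ c := by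
    intro u hu
    obtain ⟨hr, v, hv, hd⟩ := mem_thickT.1 hu
    exact mem_biUnion.2 ⟨v, hv, mem_filter.2 ⟨Fintype.mem_piFinset.2 fun i => mem_range.2 (hr i), hd⟩⟩
  refine (card_le_card hsub).trans (card_biUnion_le.trans ?_)
  calc ∑ v ∈ S, ((Fintype.piFinset fun _ : Fin d => range m).filter fun u => cdist m u v ≤ c).card
      ≤ ∑ _v ∈ S, (2 * c + 1) ^ d := sum_le_sum fun v hv => card_cball_le (hS v hv)
    _ = (2 * c + 1) ^ d * S.card := by rw [sum_const, smul_eq_mul, mul_comm]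

/-! ## §2 Linked sets -/

/-- **`ρ`-LINKED**: every two cells of `S` are joined by a chain of cells OF `S` with consecutive cyclic sup-distance
at most `ρ` (the torus version of `B13ScaleTransfer.FaceConnected`, with a radius). [folklore] -/
def Linked (m ρ : ℕ) (S : Finset (Fin d → ℕ)) : Prop :=
  ∀ u ∈ S, ∀ v ∈ S, Relation.ReflTransGen (fun a b => a ∈ S ∧ b ∈ S ∧ cdist m a b ≤ ρ) u v

/-- a larger radius links too [folklore] -/
theorem Linked.mono {m ρ ρ' : ℕ} {S : Finset (Fin d → ℕ)} (h : Linked m ρ S) (hρ : ρ ≤ ρ') : Linked m ρ' S :=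
  fun u hu v hv => Relation.ReflTransGen.mono (fun _ _ hab => ⟨hab.1, hab.2.1, hab.2.2.trans hρ⟩) _ _ (h u hu v hv)

/-- **TWO LINKED SETS SHARING A CELL HAVE A LINKED UNION.** [folklore] -/
theorem linked_union {m ρ : ℕ} {S T : Finset (Fin d → ℕ)} (hS : Linked m ρ S) (hT : Linked m ρ T)
    {z : Fin d → ℕ} (hzS : z ∈ S) (hzT : z ∈ T) : Linked m ρ (S ∪ T) := by
  have liftS : ∀ {u v : Fin d → ℕ}, Relation.ReflTransGen (fun a b => a ∈ S ∧ b ∈ S ∧ cdist m a b ≤ ρ) u v →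
      Relation.ReflTransGen (fun a b => a ∈ S ∪ T ∧ b ∈ S ∪ T ∧ cdist m a b ≤ ρ) u v :=
    fun h => Relation.ReflTransGen.mono (fun _ _ hab => ⟨mem_union_left _ hab.1, mem_union_left _ hab.2.1, hab.2.2⟩) _ _ h
  have liftT : ∀ {u v : Fin d → ℕ}, Relation.ReflTransGen (fun a b => a ∈ T ∧ b ∈ T ∧ cdist m a b ≤ ρ) u v →
      Relation.ReflTransGen (fun a b => a ∈ S ∪ T ∧ b ∈ S ∪ T ∧ cdist m a b ≤ ρ) u v :=
    fun h =>
      Relation.ReflTransGen.mono (fun _ _ hab => ⟨mem_union_right _ hab.1, mem_union_right _ hab.2.1, hab.2.2⟩) _ _ h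
  intro u hu v hv
  rcases mem_union.1 hu with hu | hu <;> rcases mem_union.1 hv with hv | hv
  · exact liftS (hS u hu v hv)
  · exact (liftS (hS u hu z hzS)).trans (liftT (hT z hzT v hv))
  · exact (liftT (hT u hu z hzT)).trans (liftS (hS z hzS v hv))
  · exact liftT (hT u hu v hv)

/-- **THICKENING KEEPS A SET LINKED** (radius `max ρ c`; the set must be in range so that it lies in its thickening).
[folklore] -/
theorem linked_thickT {m ρ : ℕ} (c : ℕ) {S : Finset (Fin d → ℕ)} (hS : InRange m S) (hl : Linked m ρ S) :
    Linked m (max ρ c) (thickT m c S) := by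
  intro u hu v hv
  obtain ⟨-, u₀, hu₀, hdu⟩ := mem_thickT.1 hu
  obtain ⟨-, v₀, hv₀, hdv⟩ := mem_thickT.1 hv
  have hsub : S ⊆ thickT m c S := subset_thickT c hS
  have h1 : Relation.ReflTransGen (fun a b => a ∈ thickT m c S ∧ b ∈ thickT m c S ∧ cdist m a b ≤ max ρ c) u u₀ :=
    Relation.ReflTransGen.single ⟨hu, hsub hu₀, hdu.trans (le_max_right _ _)⟩
  have h2 : Relation.ReflTransGen (fun a b => a ∈ thickT m c S ∧ b ∈ thickT m c S ∧ cdist m a b ≤ max ρ c) u₀ v₀ :=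
    Relation.ReflTransGen.mono (fun _ _ hab => ⟨hsub hab.1, hsub hab.2.1, hab.2.2.trans (le_max_left _ _)⟩) _ _
      (hl u₀ hu₀ v₀ hv₀)
  have h3 : Relation.ReflTransGen (fun a b => a ∈ thickT m c S ∧ b ∈ thickT m c S ∧ cdist m a b ≤ max ρ c) v₀ v :=
    Relation.ReflTransGen.single ⟨hsub hv₀, hv, by rw [cdist_comm]; exact hdv.trans (le_max_right _ _)⟩
  exact h1.trans (h2.trans h3)

/-- **BLOCKING KEEPS A SET LINKED** (radius `ρ∕L + 1`, by `cdist_blockVec_le`). [folklore] -/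
theorem linked_blocks {m L ρ : ℕ} (hL : 1 ≤ L) {S : Finset (Fin d → ℕ)} (hl : Linked (m * L) ρ S) :
    Linked m (ρ / L + 1) (blocks L S) := by
  intro u hu v hv
  obtain ⟨a, ha, rfl⟩ := mem_image.1 hu
  obtain ⟨b, hb, rfl⟩ := mem_image.1 hv
  exact Relation.ReflTransGen.lift (blockVec L) (fun x y hxy =>
    ⟨mem_image_of_mem _ hxy.1, mem_image_of_mem _ hxy.2.1,
      (cdist_blockVec_le hL m x y).trans (Nat.add_le_add_right (Nat.div_le_div_right hxy.2.2) 1)⟩) _ _ (hl a ha b hb)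

/-- **THE TORUS REDUCTION OF A FACE-CONNECTED CUBE FAMILY IS `1`-LINKED** (`ZoneBirthExtent.redZone`; a common wall is a
unit sup-step, `cycd_res_le_natAbs`). [folklore] -/
theorem linked_redZone {m : ℕ} (hm : 0 < m) {Z : Finset (B13ScaleTransfer.Pt d)} (hZ : B13ScaleTransfer.FaceConnected Z) :
    Linked m 1 (redZone m Z) := by
  intro u hu v hv
  obtain ⟨x, hx, rfl⟩ := mem_image.1 hu
  obtain ⟨y, hy, rfl⟩ := mem_image.1 hv
  have h : Relation.ReflTransGen (B13ScaleTransfer.StepIn Z) x y := hZ x hx y hy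
  exact Relation.ReflTransGen.lift (fun (w : B13ScaleTransfer.Pt d) (i : Fin d) => res m (w i)) (fun a b hab =>
    ⟨mem_image_of_mem _ hab.1, mem_image_of_mem _ hab.2.1,
      cdist_red_le hm a b 1 (natAbs_sub_le_one_of_adj hab.2.2)⟩) _ _ h

/-! ## §3 The core: a linked set meets few coarse blocks -/

/-- **ATTAINED DISTANCES ALONG A LINKING CHAIN ARE `ρ`-DENSE**: if `z ∈ S` is chained in `S` (steps `≤ ρ`, `ρ ≥ 1`) to a
cell `w`, then for every `r ≤ cdist z w` some cell of `S` sits at distance in `[r − (ρ−1), r]` from `z`. [folklore] -/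
theorem exists_mem_cdist_window {M ρ : ℕ} (hρ : 1 ≤ ρ) {S : Finset (Fin d → ℕ)} (hS : InRange M S)
    {z w : Fin d → ℕ} (hz : z ∈ S)
    (h : Relation.ReflTransGen (fun a b => a ∈ S ∧ b ∈ S ∧ cdist M a b ≤ ρ) z w) :
    ∀ r, r ≤ cdist M z w → ∃ a ∈ S, cdist M z a ≤ r ∧ r ≤ cdist M z a + (ρ - 1) := by
  induction h with
  | refl =>
      intro r hr
      rw [cdist_self] at hr
      refine ⟨z, hz, ?_, ?_⟩
      · rw [cdist_self]; exact Nat.zero_le _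
      · omega
  | @tail x y _ hxy ih =>
      obtain ⟨hx, hy, hd⟩ := hxy
      intro r hr
      by_cases hrx : r ≤ cdist M z x
      · exact ih r hrx
      · by_cases hry : cdist M z y ≤ r
        · exact ⟨y, hy, hry, by omega⟩
        · have htri := cdist_triangle (hS z hz) (hS x hx) (hS y hy)
          push Not at hrx hry
          exact ⟨x, hx, hrx.le, by omega⟩

section Core

open scoped Classical

/-- **THE CORE: A `ρ`-LINKED SET OF CELLS MEETS FEW COARSE BLOCKS.**  For `S ⊆ (ℤ∕mN)^d` in range, `ρ`-linked with
`ρ ≥ 1`, and a blocking factor `N ≥ 1`: `#blocks N S · N ≤ 5^d·(ρ·#S + N)`. [folklore] -/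
theorem card_blocks_le_of_linked {m N ρ : ℕ} (hN : 1 ≤ N) (hρ : 1 ≤ ρ) {S : Finset (Fin d → ℕ)}
    (hS : InRange (m * N) S) (hlink : Linked (m * N) ρ S) :
    (blocks N S).card * N ≤ 5 ^ d * (ρ * S.card + N) := by
  set B := blocks N S with hB
  have hBr : InRange m B := inRange_blocks hN hS
  -- (1) a 3-separated sub-family of the met blocks of MAXIMAL size covers them within distance 2
  set F := B.powerset.filter fun T => ∀ x ∈ T, ∀ y ∈ T, x ≠ y → 3 ≤ cdist m x y with hF
  have hFne : F.Nonempty := ⟨∅, by simp [hF]⟩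
  obtain ⟨T, hTF, hTmax⟩ := exists_max_image F card hFne
  have hTB : T ⊆ B := mem_powerset.1 (mem_filter.1 hTF).1
  have hsep : ∀ x ∈ T, ∀ y ∈ T, x ≠ y → 3 ≤ cdist m x y := (mem_filter.1 hTF).2
  have hcov : ∀ b ∈ B, ∃ t ∈ T, cdist m b t ≤ 2 := by
    intro b hb
    by_contra hcon
    push Not at hcon
    have hbT : b ∉ T := fun h => by have := hcon b h; rw [cdist_self] at this; omega
    have hins : insert b T ∈ F := by
      rw [hF, mem_filter, mem_powerset]
      refine ⟨insert_subset hb hTB, fun x hx y hy hxy => ?_⟩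
      rw [mem_insert] at hx hy
      rcases hx with rfl | hx <;> rcases hy with rfl | hy
      · exact absurd rfl hxy
      · exact hcon y hy
      · rw [cdist_comm]; exact hcon x hx
      · exact hsep x hx y hy hxy
    have := hTmax _ hins
    rw [card_insert_of_notMem hbT] at this
    omega
  have h1 : B.card ≤ 5 ^ d * T.card := by
    have hsub : B ⊆ T.biUnion fun t =>
        (Fintype.piFinset fun _ : Fin d => range m).filter fun u => cdist m u t ≤ 2 := by
      intro b hb
      obtain ⟨t, ht, hd⟩ := hcov b hb
      exact mem_biUnion.2 ⟨t, ht, mem_filter.2 ⟨Fintype.mem_piFinset.2 fun i => mem_range.2 (hBr b hb i), hd⟩⟩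
    refine (card_le_card hsub).trans (card_biUnion_le.trans ?_)
    calc ∑ t ∈ T, ((Fintype.piFinset fun _ : Fin d => range m).filter fun u => cdist m u t ≤ 2).card
        ≤ ∑ _t ∈ T, 5 ^ d := sum_le_sum fun t ht => by
          have h := card_cball_le (c := 2) (hBr t (hTB ht))
          norm_num at h
          exact h
      _ = 5 ^ d * T.card := by rw [sum_const, smul_eq_mul, mul_comm]
  -- (2) representatives of distinct separated blocks are `≥ 2N` apart
  have hrep : ∀ t ∈ T, ∃ z ∈ S, blockVec N z = t := fun t ht => by
    obtain ⟨z, hz, h⟩ := mem_image.1 (hTB ht)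
    exact ⟨z, hz, h⟩
  choose! z hzS hzb using hrep
  have hfar : ∀ t ∈ T, ∀ t' ∈ T, t ≠ t' → 2 * N ≤ cdist (m * N) (z t) (z t') := by
    intro t ht t' ht' hne
    have h3 := hsep t ht t' ht' hne
    rw [← hzb t ht, ← hzb t' ht'] at h3
    have h4 := h3.trans (cdist_blockVec_le hN m (z t) (z t'))
    have h5 : 2 ≤ cdist (m * N) (z t) (z t') / N := by omega
    exact (Nat.le_div_iff_mul_le hN).1 h5
  -- (3) the radius-(N−1) territories of the representatives: pairwise disjoint, each of size `≥ ⌊(N−1)∕ρ⌋ + 1`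
  set terr : (Fin d → ℕ) → Finset (Fin d → ℕ) := fun t => S.filter fun a => cdist (m * N) (z t) a ≤ N - 1
    with hterr
  have hdisj : ∀ t ∈ T, ∀ t' ∈ T, t ≠ t' → Disjoint (terr t) (terr t') := by
    intro t ht t' ht' hne
    rw [Finset.disjoint_left]
    intro a ha ha'
    simp only [hterr, mem_filter] at ha ha'
    have hfar' := hfar t ht t' ht' hne
    have htri := cdist_triangle (hS _ (hzS t ht)) (hS a ha.1) (hS _ (hzS t' ht'))
    rw [cdist_comm (m * N) a (z t')] at htri
    omega
  set K := (N - 1) / ρ + 1 with hK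
  have hKρ : N ≤ K * ρ := by
    have := Nat.lt_div_mul_add (a := N - 1) hρ
    rw [hK, add_mul, one_mul]
    omega
  have hsize : ∀ t ∈ T, (∃ t' ∈ T, t' ≠ t) → K ≤ (terr t).card := by
    rintro t ht ⟨t', ht', hne⟩
    have hw := hfar t ht t' ht' hne.symm
    have hdense := exists_mem_cdist_window hρ hS (hzS t ht) (hlink (z t) (hzS t ht) (z t') (hzS t' ht'))
    choose! a haS hale hage using hdense
    have hr : ∀ i ∈ range K, i * ρ ≤ cdist (m * N) (z t) (z t') := fun i hi => by
      rw [mem_range, hK] at hi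
      have h1 : i * ρ ≤ (N - 1) / ρ * ρ := Nat.mul_le_mul_right ρ (by omega)
      have h2 : (N - 1) / ρ * ρ ≤ N - 1 := Nat.div_mul_le_self (N - 1) ρ
      omega
    have hmaps : ∀ i ∈ range K, a (i * ρ) ∈ terr t := fun i hi => by
      simp only [hterr, mem_filter]
      refine ⟨haS _ (hr i hi), ?_⟩
      have h1 := hale _ (hr i hi)
      rw [mem_range, hK] at hi
      have h2 : i * ρ ≤ (N - 1) / ρ * ρ := Nat.mul_le_mul_right ρ (by omega)
      have h3 : (N - 1) / ρ * ρ ≤ N - 1 := Nat.div_mul_le_self (N - 1) ρ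
      omega
    have hinj : Set.InjOn (fun i => a (i * ρ)) (range K : Finset ℕ) := by
      intro i hi j hj hij
      simp only at hij
      have hi' := hr i (mem_coe.1 hi)
      have hj' := hr j (mem_coe.1 hj)
      by_contra hne'
      rcases Nat.lt_or_gt_of_ne hne' with hlt | hlt
      · have h1 := hale _ hi'
        have h2 := hage _ hj'
        rw [hij] at h1
        have h3 : (i + 1) * ρ ≤ j * ρ := Nat.mul_le_mul_right ρ hlt
        rw [add_mul, one_mul] at h3
        omega
      · have h1 := hale _ hj'
        have h2 := hage _ hi'
        rw [← hij] at h1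
        have h3 : (j + 1) * ρ ≤ i * ρ := Nat.mul_le_mul_right ρ hlt
        rw [add_mul, one_mul] at h3
        omega
    calc K = (range K).card := (card_range K).symm
      _ ≤ (terr t).card := card_le_card_of_injOn (fun i => a (i * ρ)) (fun i hi => hmaps i (mem_coe.1 hi)) hinj
  -- (4) conclusion
  by_cases hT1 : T.card ≤ 1
  · calc B.card * N ≤ 5 ^ d * T.card * N := Nat.mul_le_mul_right N h1
      _ ≤ 5 ^ d * 1 * N := by gcongr
      _ ≤ 5 ^ d * (ρ * S.card + N) := by rw [mul_one]; exact Nat.mul_le_mul_left _ (by omega)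
  · push Not at hT1
    have hsum : T.card * K ≤ S.card := by
      have hU : (T.biUnion terr) ⊆ S := by
        intro a ha
        obtain ⟨t, -, hat⟩ := mem_biUnion.1 ha
        simp only [hterr, mem_filter] at hat
        exact hat.1
      calc T.card * K = ∑ _t ∈ T, K := by rw [sum_const, smul_eq_mul]
        _ ≤ ∑ t ∈ T, (terr t).card :=
            sum_le_sum fun t ht => hsize t ht (exists_mem_ne hT1 t)
        _ = (T.biUnion terr).card := (card_biUnion hdisj).symm
        _ ≤ S.card := card_le_card hU
    calc B.card * N ≤ 5 ^ d * T.card * N := Nat.mul_le_mul_right N h1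
      _ ≤ 5 ^ d * (T.card * (K * ρ)) := by rw [mul_assoc]; gcongr
      _ = 5 ^ d * (T.card * K * ρ) := by ring
      _ ≤ 5 ^ d * (S.card * ρ) := by gcongr
      _ ≤ 5 ^ d * (ρ * S.card + N) := by rw [mul_comm S.card ρ]; exact Nat.mul_le_mul_left _ (Nat.le_add_right _ _)

/-- the same in real form: `#blocks N S ≤ 5^d·(ρ·#S∕N + 1)` [folklore] -/
theorem card_blocks_le_of_linked_real {m N ρ : ℕ} (hN : 1 ≤ N) (hρ : 1 ≤ ρ) {S : Finset (Fin d → ℕ)}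
    (hS : InRange (m * N) S) (hlink : Linked (m * N) ρ S) :
    ((blocks N S).card : ℝ) ≤ (5 : ℝ) ^ d * ((ρ : ℝ) * S.card / N + 1) := by
  have h := card_blocks_le_of_linked hN hρ hS hlink
  have hN' : (0 : ℝ) < N := by exact_mod_cast hN
  have hN0 : (N : ℝ) ≠ 0 := hN'.ne'
  have h' : ((blocks N S).card : ℝ) * N ≤ (5 : ℝ) ^ d * ((ρ : ℝ) * S.card + N) := by exact_mod_cast h
  rw [div_add_one hN0, ← mul_div_assoc, le_div_iff₀ hN']
  exact h'

end Core

/-! ## §4 Iteration algebra for the tolerant step law -/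

/-- **BLOCKING A THICKENING LIES IN A THICKENING OF THE BLOCKING**:
`blocks L (thickT (m·L) c S) ⊆ thickT m (c∕L + 1) (blocks L S)`. [folklore] -/
theorem blocks_thickT_subset {L : ℕ} (hL : 1 ≤ L) (m c : ℕ) (S : Finset (Fin d → ℕ)) :
    blocks L (thickT (m * L) c S) ⊆ thickT m (c / L + 1) (blocks L S) := by
  intro u hu
  obtain ⟨a, ha, rfl⟩ := mem_image.1 hu
  obtain ⟨har, v, hv, hd⟩ := mem_thickT.1 ha
  refine mem_thickT.2 ⟨fun i => (Nat.div_lt_iff_lt_mul hL).2 (har i), blockVec L v, mem_image_of_mem _ hv, ?_⟩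
  exact (cdist_blockVec_le hL m a v).trans (Nat.add_le_add_right (Nat.div_le_div_right hd) 1)

/-- **THICKENING TWICE LIES IN ONE THICKENING BY THE SUM** (set in range). [folklore] -/
theorem thickT_thickT_subset {m : ℕ} (c c' : ℕ) {S : Finset (Fin d → ℕ)} (hS : InRange m S) :
    thickT m c (thickT m c' S) ⊆ thickT m (c + c') S := by
  intro u hu
  obtain ⟨hur, w, hw, hd⟩ := mem_thickT.1 hu
  obtain ⟨hwr, v, hv, hd'⟩ := mem_thickT.1 hw
  exact mem_thickT.2 ⟨hur, v, hv, (cdist_triangle hur hwr (hS v hv)).trans (Nat.add_le_add hd hd')⟩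

/-- a larger radius thickens more [folklore] -/
theorem thickT_mono_radius (m : ℕ) {c c' : ℕ} (h : c ≤ c') (S : Finset (Fin d → ℕ)) :
    thickT m c S ⊆ thickT m c' S := by
  intro u hu
  obtain ⟨hur, v, hv, hd⟩ := mem_thickT.1 hu
  exact mem_thickT.2 ⟨hur, v, hv, hd.trans h⟩

/-! ## §5 Sanity -/

namespace Sanity

/-- blocking `(ℤ∕8)²` by `2`: the four cells of a `2×2` block collapse to one block (decided) [folklore] -/
example : blocks 2 ({![0, 0], ![0, 1], ![1, 0], ![1, 1]} : Finset (Fin 2 → ℕ)) = {![0, 0]} := by decide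

end Sanity

end

end Summit.QuantumFields.BalabanUV.T4Continuum.HistoryZoneMass
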